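import Summits.QuantumFields.BalabanUV.T4Continuum.Support.NE7K1LinBoxResolventImages
import Summits.QuantumFields.BalabanUV.T4Continuum.Support.NE7K1LinTorusResolventDeriv

/-!
# NE7K1LinBoxResolventImagesDeriv — row NE7 (node U5), candidate route HOM, path H1L, cell K1-lin(s): NEEDS-ESTIMATE #E1, R-E1 —
# THE BOUNDARY-CONDITION LAYER (o3), PART 2: LEMMA 2.4 (2.35), SECOND QUANTITY, AND THE HÖLDER QUOTIENT (2.36) FOR THE TWO-CUTOFF
# LINE'S AVERAGED RESOLVENT `(T^Π(s) + a·Q_n^*Q_n)⁻¹Q_n^*` ON A NEUMANN BOX — constants in `(d, a₋, a₊[, α])` ONLY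

Lineage `b2b-balaban-t4-ne7-p2` (CRUX PROVER NE7 #2), generation 77; file 79 (= file 77's images identity + file 78's torus
dictionary).  The fold of file 34 acts on the SOURCE variable only, so differences in the FIRST (field) argument pass through it
unchanged: for box points `y, y + e_μ` (and `y + sv, y + sv + e_μ`) of `Π`, the first ∕ weighted second differences of
`Σ_{y′ ∈ Π} G^Π(s)(·, y′)·1[blk_n y′ = β]` are the sums over the `2^{d+1}` coarse images `σ_ε β` of the corresponding differences of
the doubled-torus kernel, which file 78 identified with `torusKernelDS` ∕ `torusKernelHS` of files 69–71.

* §1 `norm_sum_images_le` — the common tail: a kernel bound `‖K x‖ ≤ C·e^{−κ′·dist_{𝕋(2M)}(x)}` gives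
  `‖Σ_ε K(y₀ − σ_ε β)‖ ≤ 2^{d+1}·C·e^{−κ′|y₀ − β|_∞}` on the box (file 77's geometry `supNorm_le_torusSupNorm_image`).
* §2 **`boxResolventKernel_step_eq_images`**: `n·[S(y + e_μ) − S(y)] = Σ_ε torusKernelDS n (lineSymb L n s) a τ μ (2M) (y₀ − σ_ε β)`,
  `S(w) := Σ_{y′ ∈ Π} G^Π(s)(w, y′)·1[blk_n y′ = β]`, `y = n·y₀ + τ`; **`boxResolventKernel_step_decay`** — LEMMA 2.4 (2.35), SECOND
  QUANTITY «`|(∂_μ^{L^{−j}} G_j(□)Q_j^*)(x, y)| ≤ c₀e^{−δ₀|x−y|}`» FOR THE LINE ON EVERY NEUMANN BOX: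
  `‖n·[S(y + e_μ) − S(y)]‖ ≤ 2^{d+1}·MD_line(d,a₋)·periodConst(κ_line, d)·e^{−(κ_line∕(d+1))|y₀ − β|_∞}`.
* §3 **`boxResolventKernel_holder_eq_images`** and **`boxResolventKernel_holder_decay`** — (2.36)
  «`(1∕|x−x′|^α)|(∂_μ G_j(□)Q_j^*)(x, y) − (∂_μ G_j(□)Q_j^*)(x′, y)| ≤ c₁e^{−δ₀ dist({x,x′},y)}`» FOR THE LINE ON EVERY NEUMANN BOX: for
  `0 ≤ α < 1`, a fine displacement `sv ≠ 0` with `|sv_ν| ≤ n` (`x′ − x = sv∕n`, `|x − x′| ≤ 1`) and the four box points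
  `y, y + e_μ, y + sv, y + sv + e_μ ∈ Π`:
  `(n∕|sv|_∞)^α·‖n·[(S(y+sv+e_μ) − S(y+sv)) − (S(y+e_μ) − S(y))]‖ ≤ 2^{d+1}·MH_line(d,α,a₋)·periodConst(κ_line, d)·e^{−(κ_line∕(d+1))|y₀ − β|_∞}`
  (decay from the base point `y`; B4's `dist({x,x′},y) ≤ |x − y|`).
  EVERY `s ∈ [0,1]`, `a ∈ [a₋,a₊]`, mesh `n ≥ 1`, `L ≥ 1`, box `M`; constants and rate functions of `(d, a₋, a₊[, α])` ALONE ((k1));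
  `s` only through `0 ≤ s ≤ 1` ((k2)); docking through the centred cell inherited from file 76 ((k3)).

What (o3) still lacks after files 77–79 (HONEST): nothing on BOXES for the three quantities of Lemma 2.4 (2.35)–(2.36); for general
unions of big blocks the Cor. 2.3-type layers beyond generation 70–71's random-walk entry decay remain as the refuter prices them; (o2)
(B4 (2.37), the unit-lattice propagator `C^{(j)}` built from the line) is untouched.

HONEST FRAMING: [folklore]; finite identities plus the triangle inequality over `2^{d+1}` images; nothing of Bałaban's asserted; no
`sorry`.  Census only (#E1's (o3), box layer, second and third quantities); NE7 NOT PRINTED ∕ NOT PROVED; spine 0∕9; FIXED FINITE T⁴,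
rung (B)+1; NOT infinite volume, NOT mass gap, NOT Clay.  HONEST DEPENDENCY: continuum YM on T⁴ ⇐ BetaPertH ∧ nine spine estimates
(0/9 proved); BetaPertH ⇐ (D1) ∧ (D4) ∧ CAP+tail; G-an2-4 gates asym, D1 and NE2/3/4.
-/

noncomputable section

open Finset Matrix Complex

namespace Summit.QuantumFields.BalabanUV.T4Continuum.NE7K1LinBoxResolventImagesDeriv

open Literature.MathematicalPhysics.QuantumFieldTheory.Balaban1983to89
open Literature.MathematicalPhysics.QuantumFieldTheory.Balaban1983to89.B4Reflection242
open Literature.MathematicalPhysics.QuantumFieldTheory.Balaban1983to89.B4Lower18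
open Literature.MathematicalPhysics.QuantumFieldTheory.Balaban1983to89.B4Green244 (finePt coarse offset coarse_finePt
  finePt_coarse_offset e)
open Literature.MathematicalPhysics.QuantumFieldTheory.Balaban1983to89.B4ContourShift (supNorm)
open Literature.MathematicalPhysics.QuantumFieldTheory.Balaban1983to89.B4TorusKernel (periodConst)
open Literature.MathematicalPhysics.QuantumFieldTheory.Balaban1983to89.B4TorusKernel.MultiPeriod (torusSupNorm)
open NE7K1LinFoldKernels NE7K1LinFoldMatrices NE7K1LinSchurFold NE7K1LinSchurFoldBox NE7K1LinSchurLineU1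
open NE7K1LinStripClass NE7K1LinStripClassCauchy NE7K1LinStripClassLine NE7K1LinStripClassSums NE7K1LinStripClassLineDecay
open NE7K1LinStripClassSumsDeriv NE7K1LinStripClassSumsHolder NE7K1LinStripClassLineHolder
open NE7K1LinTorusResolventInverse NE7K1LinTorusResolventDeriv NE7K1LinBoxResolventImages

variable {d : ℕ}

/-! ### §1 The common tail: summing a torus-decaying kernel over the images -/

/-- summing a kernel with torus decay over the `2^{d+1}` images of a box label: `‖Σ_ε K(y₀ − σ_ε β)‖ ≤ 2^{d+1}·C·e^{−κ′|y₀ − β|_∞}`.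
[folklore] -/
theorem norm_sum_images_le {M : Fin (d + 1) → ℕ} {K : (Fin (d + 1) → ℤ) → ℂ} {C κ' : ℝ} (hκ' : 0 ≤ κ')
    (hK : ∀ x, ‖K x‖ ≤ C * Real.exp (-(κ' * torusSupNorm (dbl M) x))) {y₀ β : Fin (d + 1) → ℤ} (hy₀ : y₀ ∈ boxDom M)
    (hβ : β ∈ boxDom M) :
    ‖∑ ε : Fin (d + 1) → Bool, K (y₀ - reflBox M ε (fun i => if ε i then 1 else 0) β)‖ ≤
      2 ^ (d + 1) * C * Real.exp (-(κ' * supNorm (y₀ - β))) := by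
  have hterm : ∀ ε : Fin (d + 1) → Bool,
      ‖K (y₀ - reflBox M ε (fun i => if ε i then 1 else 0) β)‖ ≤ C * Real.exp (-(κ' * supNorm (y₀ - β))) := by
    intro ε
    have h := hK (y₀ - reflBox M ε (fun i => if ε i then 1 else 0) β)
    refine h.trans ?_
    have hE : 0 < Real.exp (-(κ' * torusSupNorm (dbl M) (y₀ - reflBox M ε (fun i => if ε i then 1 else 0) β))) :=
      Real.exp_pos _
    have hC0 : 0 ≤ C := by
      by_contra hneg
      push Not at hneg
      have := mul_neg_of_neg_of_pos hneg hE
      linarith [norm_nonneg (K (y₀ - reflBox M ε (fun i => if ε i then 1 else 0) β))]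
    refine mul_le_mul_of_nonneg_left (Real.exp_le_exp.2 ?_) hC0
    have hg := supNorm_le_torusSupNorm_image hy₀ hβ ε
    nlinarith
  calc ‖∑ ε : Fin (d + 1) → Bool, K (y₀ - reflBox M ε (fun i => if ε i then 1 else 0) β)‖
      ≤ ∑ ε : Fin (d + 1) → Bool, ‖K (y₀ - reflBox M ε (fun i => if ε i then 1 else 0) β)‖ := norm_sum_le _ _
    _ ≤ ∑ _ε : Fin (d + 1) → Bool, C * Real.exp (-(κ' * supNorm (y₀ - β))) := Finset.sum_le_sum fun ε _ => hterm ε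
    _ = 2 ^ (d + 1) * C * Real.exp (-(κ' * supNorm (y₀ - β))) := by
      rw [Finset.sum_const, Finset.card_univ, Fintype.card_fun, Fintype.card_bool, Fintype.card_fin, nsmul_eq_mul]
      push_cast
      ring

section Box

variable {n L : ℕ} [NeZero n] [NeZero L] {M : Fin (d + 1) → ℕ}

omit [NeZero n] in
/-- the block label of a box label `y = n·y₀ + τ` lies in the coarse box. [folklore] -/
theorem coarse_boxLabel_mem (hn : 1 ≤ n) (y : ↥((boxDom fun i => n * L * M i).image (blk L))) {y₀ : Fin (d + 1) → ℤ}
    {τ : Fin (d + 1) → Fin n} (hy : y.1 = finePt n y₀ τ) : y₀ ∈ boxDom M := by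
  haveI : NeZero n := ⟨by omega⟩
  have h2 : blk n y.1 = y₀ := by rw [hy]; exact coarse_finePt n y₀ τ
  rw [← h2]; exact blk_mem_boxDom hn (boxLabel_mem y)

/-! ### §2 (2.35), second quantity: the first difference in the field argument -/

/-- **THE FIRST DIFFERENCE BY IMAGES**: for `a > 0`, `0 ≤ s ≤ 1`, box labels `y = n·y₀ + τ` and `y₁ = y + e_μ` of `Π`, and a coarse
label `β ∈ boxDom M`: `n·[S(y + e_μ) − S(y)] = Σ_ε torusKernelDS n (lineSymb L n s) a τ μ (2M) (y₀ − σ_ε β)`,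
`S(w) = Σ_{y′ ∈ Π} G^Π(s)(w, y′)·1[blk_n y′ = β]` (file 77's images identity at `y` and `y + e_μ`, file 78's `torusKernelS_step` image by
image). [folklore] -/
theorem boxResolventKernel_step_eq_images (hn : 1 ≤ n) (hM : ∀ i, 1 ≤ M i) {a : ℝ} (ha : 0 < a) {s : ℝ} (hs0 : 0 ≤ s)
    (hs1 : s ≤ 1) (y y₁ : ↥((boxDom fun i => n * L * M i).image (blk L))) {y₀ : Fin (d + 1) → ℤ}
    {τ : Fin (d + 1) → Fin n} (hy : y.1 = finePt n y₀ τ) (μ : Fin (d + 1)) (hy₁ : y₁.1 = y.1 + e μ)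
    {β : Fin (d + 1) → ℤ} (hβ : β ∈ boxDom M) :
    (n : ℂ) * (∑ y' : ↥((boxDom fun i => n * L * M i).image (blk L)),
        (((twoCutoffLine (isBlockUnion_fine (fineBox_isBlockUnion hn (NeZero.one_le : 1 ≤ L) M)) n a s)⁻¹ y₁ y' : ℝ) : ℂ) *
          (if blk n y'.1 = β then (1 : ℂ) else 0) -
      ∑ y' : ↥((boxDom fun i => n * L * M i).image (blk L)),
        (((twoCutoffLine (isBlockUnion_fine (fineBox_isBlockUnion hn (NeZero.one_le : 1 ≤ L) M)) n a s)⁻¹ y y' : ℝ) : ℂ) *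
          (if blk n y'.1 = β then (1 : ℂ) else 0)) =
      ∑ ε : Fin (d + 1) → Bool,
        torusKernelDS n (lineSymb L n s) a τ μ (dbl M) (y₀ - reflBox M ε (fun i => if ε i then 1 else 0) β) := by
  have hy₁' : y₁.1 = finePt n (coarse n (finePt n y₀ τ + e μ)) (offset n (finePt n y₀ τ + e μ)) := by
    rw [hy₁, hy, finePt_coarse_offset]
  rw [boxResolventKernel_eq_images hn hM ha hs0 hs1 y hy hβ, boxResolventKernel_eq_images hn hM ha hs0 hs1 y₁ hy₁' hβ,
    ← Finset.sum_sub_distrib, Finset.mul_sum]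
  refine Finset.sum_congr rfl fun ε _ => ?_
  exact torusKernelS_step (dbl_pos hM) (lineSymb L n s) a y₀ τ μ _

/-- **LEMMA 2.4 (2.35), SECOND QUANTITY, FOR `(T^Π(s) + aQ_n^*Q_n)⁻¹Q_n^*` ON A NEUMANN BOX** — for `a ∈ [a₋, a₊]` (`a₋ > 0`),
`0 ≤ s ≤ 1`, every mesh `n ≥ 1`, `L ≥ 1`, box `M`, direction `μ`, box labels `y = n·y₀ + τ`, `y + e_μ ∈ Π`, and `β ∈ boxDom M`:
`‖n·[S(y + e_μ) − S(y)]‖ ≤ 2^{d+1}·MD_line(d,a₋)·periodConst(κ_line(d+1,a₋,a₊), d)·e^{−(κ_line(d+1,a₋,a₊)∕(d+1))·|y₀ − β|_∞}` — constant and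
rate in `(d, a₋, a₊)` only. [folklore] -/
theorem boxResolventKernel_step_decay (hn : 1 ≤ n) (hM : ∀ i, 1 ≤ M i) {aminus aplus a : ℝ} (ha : 0 < aminus)
    (ha1 : aminus ≤ a) (ha2 : a ≤ aplus) {s : ℝ} (hs0 : 0 ≤ s) (hs1 : s ≤ 1)
    (y y₁ : ↥((boxDom fun i => n * L * M i).image (blk L))) {y₀ : Fin (d + 1) → ℤ} {τ : Fin (d + 1) → Fin n}
    (hy : y.1 = finePt n y₀ τ) (μ : Fin (d + 1)) (hy₁ : y₁.1 = y.1 + e μ) {β : Fin (d + 1) → ℤ} (hβ : β ∈ boxDom M) :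
    ‖(n : ℂ) * (∑ y' : ↥((boxDom fun i => n * L * M i).image (blk L)),
        (((twoCutoffLine (isBlockUnion_fine (fineBox_isBlockUnion hn (NeZero.one_le : 1 ≤ L) M)) n a s)⁻¹ y₁ y' : ℝ) : ℂ) *
          (if blk n y'.1 = β then (1 : ℂ) else 0) -
      ∑ y' : ↥((boxDom fun i => n * L * M i).image (blk L)),
        (((twoCutoffLine (isBlockUnion_fine (fineBox_isBlockUnion hn (NeZero.one_le : 1 ≤ L) M)) n a s)⁻¹ y y' : ℝ) : ℂ) *
          (if blk n y'.1 = β then (1 : ℂ) else 0))‖ ≤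
      2 ^ (d + 1) * (MDline d aminus * periodConst (kappaLine (d + 1) aminus aplus) d) *
        Real.exp (-(kappaLine (d + 1) aminus aplus / (d + 1) * supNorm (y₀ - β))) := by
  have ha0 : 0 < a := lt_of_lt_of_le ha ha1
  rw [boxResolventKernel_step_eq_images hn hM ha0 hs0 hs1 y y₁ hy μ hy₁ hβ]
  exact norm_sum_images_le (div_pos (kappaLine_pos (d + 1) aplus ha) (by positivity)).le
    (fun x => line_dtorusKernel_decay_torusMetric L n hs0 hs1 ha ha1 ha2 τ μ (dbl_pos hM) x)
    (coarse_boxLabel_mem hn y hy) hβ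

/-! ### §3 (2.36): the weighted second difference in the field argument -/

/-- **THE WEIGHTED SECOND DIFFERENCE BY IMAGES**: for `a > 0`, `0 ≤ s ≤ 1`, a box label `y = n·y₀ + τ`, a fine displacement `sv` and a
direction `μ` with `y + e_μ, y + sv, y + sv + e_μ ∈ Π`, and `β ∈ boxDom M`:
`(n∕|sv|_∞)^α·n·[(S(y+sv+e_μ) − S(y+sv)) − (S(y+e_μ) − S(y))] = Σ_ε torusKernelHS α n (lineSymb L n s) a τ μ sv (2M) (y₀ − σ_ε β)`. [folklore] -/
theorem boxResolventKernel_holder_eq_images (hn : 1 ≤ n) (hM : ∀ i, 1 ≤ M i) {a : ℝ} (ha : 0 < a) {s : ℝ} (hs0 : 0 ≤ s)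
    (hs1 : s ≤ 1) (α : ℝ) (y y₁ y₂ y₃ : ↥((boxDom fun i => n * L * M i).image (blk L))) {y₀ : Fin (d + 1) → ℤ}
    {τ : Fin (d + 1) → Fin n} (hy : y.1 = finePt n y₀ τ) (μ : Fin (d + 1)) (sv : Fin (d + 1) → ℤ) (hy₁ : y₁.1 = y.1 + e μ)
    (hy₂ : y₂.1 = y.1 + sv) (hy₃ : y₃.1 = y.1 + sv + e μ) {β : Fin (d + 1) → ℤ} (hβ : β ∈ boxDom M) :
    ((((n : ℝ) / supNorm sv) ^ α : ℝ) : ℂ) * ((n : ℂ) *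
      ((∑ y' : ↥((boxDom fun i => n * L * M i).image (blk L)),
          (((twoCutoffLine (isBlockUnion_fine (fineBox_isBlockUnion hn (NeZero.one_le : 1 ≤ L) M)) n a s)⁻¹ y₃ y' : ℝ) : ℂ) *
            (if blk n y'.1 = β then (1 : ℂ) else 0) -
        ∑ y' : ↥((boxDom fun i => n * L * M i).image (blk L)),
          (((twoCutoffLine (isBlockUnion_fine (fineBox_isBlockUnion hn (NeZero.one_le : 1 ≤ L) M)) n a s)⁻¹ y₂ y' : ℝ) : ℂ) *
            (if blk n y'.1 = β then (1 : ℂ) else 0)) -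
       (∑ y' : ↥((boxDom fun i => n * L * M i).image (blk L)),
          (((twoCutoffLine (isBlockUnion_fine (fineBox_isBlockUnion hn (NeZero.one_le : 1 ≤ L) M)) n a s)⁻¹ y₁ y' : ℝ) : ℂ) *
            (if blk n y'.1 = β then (1 : ℂ) else 0) -
        ∑ y' : ↥((boxDom fun i => n * L * M i).image (blk L)),
          (((twoCutoffLine (isBlockUnion_fine (fineBox_isBlockUnion hn (NeZero.one_le : 1 ≤ L) M)) n a s)⁻¹ y y' : ℝ) : ℂ) *
            (if blk n y'.1 = β then (1 : ℂ) else 0)))) =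
      ∑ ε : Fin (d + 1) → Bool,
        torusKernelHS α n (lineSymb L n s) a τ μ sv (dbl M) (y₀ - reflBox M ε (fun i => if ε i then 1 else 0) β) := by
  have hy₁' : y₁.1 = finePt n (coarse n (finePt n y₀ τ + e μ)) (offset n (finePt n y₀ τ + e μ)) := by
    rw [hy₁, hy, finePt_coarse_offset]
  have hy₂' : y₂.1 = finePt n (coarse n (finePt n y₀ τ + sv)) (offset n (finePt n y₀ τ + sv)) := by
    rw [hy₂, hy, finePt_coarse_offset]
  have hy₃' : y₃.1 = finePt n (coarse n (finePt n y₀ τ + sv + e μ)) (offset n (finePt n y₀ τ + sv + e μ)) := by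
    rw [hy₃, hy, finePt_coarse_offset]
  rw [boxResolventKernel_eq_images hn hM ha hs0 hs1 y hy hβ, boxResolventKernel_eq_images hn hM ha hs0 hs1 y₁ hy₁' hβ,
    boxResolventKernel_eq_images hn hM ha hs0 hs1 y₂ hy₂' hβ, boxResolventKernel_eq_images hn hM ha hs0 hs1 y₃ hy₃' hβ,
    ← Finset.sum_sub_distrib, ← Finset.sum_sub_distrib, ← Finset.sum_sub_distrib, Finset.mul_sum, Finset.mul_sum]
  refine Finset.sum_congr rfl fun ε _ => ?_
  exact torusKernelS_holder (dbl_pos hM) α (lineSymb L n s) a y₀ τ μ sv _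

/-- **(2.36) FOR `(T^Π(s) + aQ_n^*Q_n)⁻¹Q_n^*` ON A NEUMANN BOX** — for `0 ≤ α < 1`, `a ∈ [a₋, a₊]` (`a₋ > 0`), `0 ≤ s ≤ 1`, every mesh
`n ≥ 1`, `L ≥ 1`, box `M`, direction `μ`, fine displacement `sv ≠ 0` with `|sv_ν| ≤ n`, box labels `y = n·y₀ + τ`,
`y + e_μ, y + sv, y + sv + e_μ ∈ Π`, and `β ∈ boxDom M`:
`(n∕|sv|_∞)^α·‖n·[(S(y+sv+e_μ) − S(y+sv)) − (S(y+e_μ) − S(y))]‖ ≤ 2^{d+1}·MH_line(d,α,a₋)·periodConst(κ_line(d+1,a₋,a₊), d)·e^{−(κ_line∕(d+1))·|y₀ − β|_∞}`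
— constant and rate in `(d, α, a₋, a₊)` only. [folklore] -/
theorem boxResolventKernel_holder_decay (hn : 1 ≤ n) (hM : ∀ i, 1 ≤ M i) {aminus aplus a : ℝ} (ha : 0 < aminus)
    (ha1 : aminus ≤ a) (ha2 : a ≤ aplus) {s : ℝ} (hs0 : 0 ≤ s) (hs1 : s ≤ 1) {α : ℝ} (hα0 : 0 ≤ α) (hα1 : α < 1)
    (y y₁ y₂ y₃ : ↥((boxDom fun i => n * L * M i).image (blk L))) {y₀ : Fin (d + 1) → ℤ} {τ : Fin (d + 1) → Fin n}
    (hy : y.1 = finePt n y₀ τ) (μ : Fin (d + 1)) {sv : Fin (d + 1) → ℤ} (hsv0 : sv ≠ 0) (hsvn : ∀ ν, |sv ν| ≤ n)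
    (hy₁ : y₁.1 = y.1 + e μ) (hy₂ : y₂.1 = y.1 + sv) (hy₃ : y₃.1 = y.1 + sv + e μ) {β : Fin (d + 1) → ℤ}
    (hβ : β ∈ boxDom M) :
    ‖((((n : ℝ) / supNorm sv) ^ α : ℝ) : ℂ) * ((n : ℂ) *
      ((∑ y' : ↥((boxDom fun i => n * L * M i).image (blk L)),
          (((twoCutoffLine (isBlockUnion_fine (fineBox_isBlockUnion hn (NeZero.one_le : 1 ≤ L) M)) n a s)⁻¹ y₃ y' : ℝ) : ℂ) *
            (if blk n y'.1 = β then (1 : ℂ) else 0) -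
        ∑ y' : ↥((boxDom fun i => n * L * M i).image (blk L)),
          (((twoCutoffLine (isBlockUnion_fine (fineBox_isBlockUnion hn (NeZero.one_le : 1 ≤ L) M)) n a s)⁻¹ y₂ y' : ℝ) : ℂ) *
            (if blk n y'.1 = β then (1 : ℂ) else 0)) -
       (∑ y' : ↥((boxDom fun i => n * L * M i).image (blk L)),
          (((twoCutoffLine (isBlockUnion_fine (fineBox_isBlockUnion hn (NeZero.one_le : 1 ≤ L) M)) n a s)⁻¹ y₁ y' : ℝ) : ℂ) *
            (if blk n y'.1 = β then (1 : ℂ) else 0) -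
        ∑ y' : ↥((boxDom fun i => n * L * M i).image (blk L)),
          (((twoCutoffLine (isBlockUnion_fine (fineBox_isBlockUnion hn (NeZero.one_le : 1 ≤ L) M)) n a s)⁻¹ y y' : ℝ) : ℂ) *
            (if blk n y'.1 = β then (1 : ℂ) else 0))))‖ ≤
      2 ^ (d + 1) * (MHline d α aminus * periodConst (kappaLine (d + 1) aminus aplus) d) *
        Real.exp (-(kappaLine (d + 1) aminus aplus / (d + 1) * supNorm (y₀ - β))) := by
  have ha0 : 0 < a := lt_of_lt_of_le ha ha1
  rw [boxResolventKernel_holder_eq_images hn hM ha0 hs0 hs1 α y y₁ y₂ y₃ hy μ sv hy₁ hy₂ hy₃ hβ]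
  exact norm_sum_images_le (div_pos (kappaLine_pos (d + 1) aplus ha) (by positivity)).le
    (fun x => line_htorusKernel_decay_torusMetric L n hs0 hs1 ha ha1 ha2 τ μ hsv0 hsvn hα0 hα1 (dbl_pos hM) x)
    (coarse_boxLabel_mem hn y hy) hβ

end Box

end Summit.QuantumFields.BalabanUV.T4Continuum.NE7K1LinBoxResolventImagesDeriv

end
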